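import Literature.NumberTheory.Automorphic.IdeleClassGroupUnitMaps
import Literature.Topology.Algebra.CircleCharacterExtension
import Literature.Topology.Algebra.UnitsNonarchimedean
import HarnessLib

/-!
# Extending unitary characters from subgroups of the idele class group

Topic `NumberTheory/Automorphic`; namespace `Literature.NumberTheory.Automorphic.IdeleClassGroup`.
`K` a number field, `C_K = 𝔸_Kˣ ⧸ Kˣ` the tree's `IdeleClassGroup K`, `B ≤ C_K` ANY subgroup
containing the classes `[K_∞ˣ]` (`infUnitsToClass`), `χ : B →* S¹` a homomorphism.

* `exists_ideleClassChar_extension` (sharp form): if `x ↦ χ [x]` is continuous on `K_∞ˣ` and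
  `χ = 1` on `B ∩ [U]` for some open subgroup `U ≤ (∏_v 𝒪_v)ˣ` (`intUnitsToClass`), then `χ`
  extends to a continuous unitary character `ψ : C_K →ₜ* S¹`; in particular `χ` is continuous
  (`continuous_of_continuous_inf_of_trivialOn`);
* `exists_openSubgroup_intUnits_trivialOn`: conversely a CONTINUOUS `χ` is trivial on `B ∩ [U]` for
  some open `U` (no small subgroups in `S¹`, `(∏_v 𝒪_v)ˣ` nonarchimedean);
* **`exists_ideleClassChar_extension_of_continuous`**: every continuous unitary character of a
  subgroup `B ≤ C_K` containing `[K_∞ˣ]` is the restriction of a continuous unitary character of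
  `C_K` — with NO closedness assumption on `B` and no Pontryagin duality: the inputs are
  divisibility of `S¹`
  (`Literature.Topology.Algebra.exists_continuous_circleChar_extension_of_nhds_mul`), the openness
  of `K_∞ˣ × (∏_v 𝒪_v)ˣ → C_K` at `1` (`image_infUnits_mul_intUnits_mem_nhds`) and
  `NonarchimedeanGroup (∏_v 𝒪_v)ˣ` (`Literature/Topology/Algebra/UnitsNonarchimedean.lean`);
* `ideleClassChar_eqOn_closure`: two continuous characters agreeing on `B` agree on its closure.

For CLOSED `B` the extension statement is the classical one (Pontryagin duality: characters of a
closed subgroup of a locally compact abelian group extend — E. Hewitt, K. A. Ross, *Abstract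
Harmonic Analysis* I (1979), (24.12) [HewittRoss1979]); the idelic use is A. Weil, *Basic Number
Theory* (1967), Ch. VII §3 / J. Tate, thesis (1950), §4.1 [WeilBNT1967, TateThesis1967]. Everything
is proved. Related in the tree (not used here): the theorems
`GaloisRepresentations.HeckeCharacter.exists_isUnitary_infiniteIdeles_eq`
(`HeckeCharacterArchTypeProofs.lean`) /
`GaloisRepresentations.exists_isUnitary_infiniteIdeles_eq_unramified` (`CMTypeHeckeCharacter.lean`)
— Weil 1956 §1: a unitary Hecke character with prescribed
∞-component killing the congruence units — and the named fact
`HeckeCharacter.exists_of_unitaryArchParams_iff` (`HeckeCharacterArchExistence.lean`); they concern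
the special subgroup `B = [K_∞ˣ]·[congruence unit ideles]`, whereas here `B` is arbitrary.

## Provenance

Reproduced for the tree under the LEAN-IN-TREE rule (2026-08-18) from the pub-hodgecm cell's
package files `HodgeCM/PerL34/HeckeCharExtension.lean` (81 lines) and
`HodgeCM/PerL34/HeckeCharExtensionCont.lean` (87 lines) (DAG-node prover #10 lineage, seat pv10,
gate run 20), re-based on the tree's `IdeleClassGroup K` (the package's `UnitaryHeckeCharacter K` is
spelled `IdeleClassGroup K →ₜ* Circle`; `NumberField.X` ↦ `IdeleClassGroup.X` with
`unitaryHeckeCharacter` ↦ `ideleClassChar` in the names), otherwise verbatim with added docstrings.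
-/

set_option autoImplicit false

noncomputable section

open _root_.Topology Filter Set
open NumberField IsDedekindDomain

namespace Literature.NumberTheory.Automorphic.IdeleClassGroup

open Literature.Topology.Algebra (exists_continuous_circleChar_extension_of_nhds_mul_of_trivialOn
  exists_continuous_circleChar_extension_of_nhds_mul exists_openSubgroup_trivialOn)

variable (K : Type) [Field K] [NumberField K]

/-- **Extension, sharp form.** A homomorphism `χ : B → S¹` on a subgroup `B ≤ C_K` containing the
classes of `K_∞ˣ`, continuous along `K_∞ˣ` and trivial on `B ∩ [U]` for an open subgroup
`U ≤ (∏_v 𝒪_v)ˣ`, extends to a continuous unitary character of `C_K`.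
[cite: WeilBNT1967, Ch. VII §3] -/
theorem exists_ideleClassChar_extension (B : Subgroup (IdeleClassGroup K))
    (hNB : ∀ x : (InfiniteAdeleRing K)ˣ, infUnitsToClass K x ∈ B) (χ : B →* Circle)
    (hχinf : Continuous fun x : (InfiniteAdeleRing K)ˣ => χ ⟨infUnitsToClass K x, hNB x⟩)
    (U : OpenSubgroup (integralAdeles K)ˣ)
    (hU : ∀ b : B, (b : IdeleClassGroup K) ∈
      (U : Subgroup (integralAdeles K)ˣ).map (intUnitsToClass K) → χ b = 1) :
    ∃ ψ : IdeleClassGroup K →ₜ* Circle, ∀ b : B, ψ (b : IdeleClassGroup K) = χ b := by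
  obtain ⟨χ', hcont, hext⟩ :=
    exists_continuous_circleChar_extension_of_nhds_mul_of_trivialOn (G := IdeleClassGroup K)
      (N := (InfiniteAdeleRing K)ˣ) (K := (integralAdeles K)ˣ) B (infUnitsToClass K)
      (intUnitsToClass K) hNB (fun _ hs => image_infUnits_mul_intUnits_mem_nhds K hs) χ hχinf U hU
  exact ⟨{ χ' with continuous_toFun := hcont }, hext⟩

/-- In particular such a `χ` is continuous on `B` (subspace topology of `C_K`). [folklore] -/
theorem continuous_of_continuous_inf_of_trivialOn (B : Subgroup (IdeleClassGroup K))
    (hNB : ∀ x : (InfiniteAdeleRing K)ˣ, infUnitsToClass K x ∈ B) (χ : B →* Circle)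
    (hχinf : Continuous fun x : (InfiniteAdeleRing K)ˣ => χ ⟨infUnitsToClass K x, hNB x⟩)
    (U : OpenSubgroup (integralAdeles K)ˣ)
    (hU : ∀ b : B, (b : IdeleClassGroup K) ∈
      (U : Subgroup (integralAdeles K)ˣ).map (intUnitsToClass K) → χ b = 1) :
    Continuous χ := by
  obtain ⟨ψ, hψ⟩ := exists_ideleClassChar_extension K B hNB χ hχinf U hU
  have h : (χ : B → Circle) = fun b : B => ψ (b : IdeleClassGroup K) :=
    funext fun b => (hψ b).symm
  rw [h]
  exact ψ.continuous.comp continuous_subtype_val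

/-- Two continuous unitary characters of `C_K` agreeing on a subgroup `B` agree on its closure.
[folklore] -/
theorem ideleClassChar_eqOn_closure {ψ₁ ψ₂ : IdeleClassGroup K →ₜ* Circle}
    (B : Subgroup (IdeleClassGroup K)) (h : ∀ b : B, ψ₁ (b : IdeleClassGroup K) = ψ₂ b) :
    Set.EqOn ψ₁ ψ₂ (closure (B : Set (IdeleClassGroup K))) :=
  Set.EqOn.closure (fun x hx => h ⟨x, hx⟩) ψ₁.continuous ψ₂.continuous

/-- **Extension, two-continuity form.** `χ` continuous along `K_∞ˣ` and along `(∏_v 𝒪_v)ˣ`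
(pulled back) extends to a continuous unitary character of `C_K`.
[cite: WeilBNT1967, Ch. VII §3] -/
theorem exists_ideleClassChar_extension_of_continuous_inf_int (B : Subgroup (IdeleClassGroup K))
    (hNB : ∀ x : (InfiniteAdeleRing K)ˣ, infUnitsToClass K x ∈ B) (χ : B →* Circle)
    (hχinf : Continuous fun x : (InfiniteAdeleRing K)ˣ => χ ⟨infUnitsToClass K x, hNB x⟩)
    (hχint : Continuous fun u : B.comap (intUnitsToClass K) => χ ⟨intUnitsToClass K u, u.2⟩) :
    ∃ ψ : IdeleClassGroup K →ₜ* Circle, ∀ b : B, ψ (b : IdeleClassGroup K) = χ b := by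
  obtain ⟨χ', hcont, hext⟩ :=
    exists_continuous_circleChar_extension_of_nhds_mul (G := IdeleClassGroup K)
      (N := (InfiniteAdeleRing K)ˣ) (K := (integralAdeles K)ˣ) B (infUnitsToClass K)
      (intUnitsToClass K) hNB (fun _ hs => image_infUnits_mul_intUnits_mem_nhds K hs) χ hχinf hχint
  exact ⟨{ χ' with continuous_toFun := hcont }, hext⟩

/-- **Every continuous unitary character of a subgroup `B ≤ C_K` containing the classes of `K_∞ˣ`
is the restriction of a continuous unitary character of `C_K`** (no closedness of `B` needed).
[cite: HewittRoss1979, (24.12)] -/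
theorem exists_ideleClassChar_extension_of_continuous (B : Subgroup (IdeleClassGroup K))
    (hNB : ∀ x : (InfiniteAdeleRing K)ˣ, infUnitsToClass K x ∈ B) (χ : B →* Circle)
    (hχ : Continuous χ) :
    ∃ ψ : IdeleClassGroup K →ₜ* Circle, ∀ b : B, ψ (b : IdeleClassGroup K) = χ b := by
  refine exists_ideleClassChar_extension_of_continuous_inf_int K B hNB χ ?_ ?_
  · exact hχ.comp ((continuous_infUnitsToClass K).subtype_mk _)
  · exact hχ.comp (((continuous_intUnitsToClass K).comp continuous_subtype_val).subtype_mk _)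

/-- **The conductor exists**: a continuous unitary character of a subgroup `B ≤ C_K` is trivial on
`B ∩ [U]` for some open subgroup `U ≤ (∏_v 𝒪_v)ˣ` (no small subgroups in `S¹`;
`(∏_v 𝒪_v)ˣ` is nonarchimedean). [cite: TateThesis1967, §4.1] -/
theorem exists_openSubgroup_intUnits_trivialOn (B : Subgroup (IdeleClassGroup K)) (χ : B →* Circle)
    (hχ : Continuous χ) :
    ∃ U : OpenSubgroup (integralAdeles K)ˣ,
      ∀ b : B, (b : IdeleClassGroup K) ∈
        (U : Subgroup (integralAdeles K)ˣ).map (intUnitsToClass K) → χ b = 1 := by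
  let BK : Subgroup (integralAdeles K)ˣ := B.comap (intUnitsToClass K)
  let χK : BK →* Circle := χ.comp ((intUnitsToClass K).subgroupComap B)
  have hχK : Continuous χK :=
    hχ.comp (((continuous_intUnitsToClass K).comp continuous_subtype_val).subtype_mk _)
  obtain ⟨U, hU⟩ := exists_openSubgroup_trivialOn (G := (integralAdeles K)ˣ) BK χK hχK
  refine ⟨U, fun b hb => ?_⟩
  obtain ⟨u, hu, hub⟩ := Subgroup.mem_map.mp hb
  have huB : intUnitsToClass K u ∈ B := by rw [hub]; exact b.2
  have h := hU ⟨u, huB⟩ hu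
  have heq : χK ⟨u, huB⟩ = χ b := by
    show χ (((intUnitsToClass K).subgroupComap B) ⟨u, huB⟩) = χ b
    congr 1
    exact Subtype.ext hub
  rw [heq] at h
  exact h

end Literature.NumberTheory.Automorphic.IdeleClassGroup

end
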